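import Mathlib.Analysis.SpecialFunctions.ExpDeriv
import Mathlib.Analysis.SpecialFunctions.Sqrt
import Mathlib.Analysis.SpecialFunctions.Pow.Real
import Mathlib.Analysis.Calculus.Deriv.Inv
import Mathlib.Analysis.Calculus.Deriv.Mul
import HarnessLib

/-!
# The explicit ODE barriers of Shi–Wang–Wei's quasi-spherical lapse equation (Claim 2.2)

Topic `Literature/Geometry/Riemannian`; companion of `BoundaryMetricExtension.lean` (named fact
`ShiWangWei2022_boundaryMetric_extends_psc`, Shi–Wang–Wei, J. reine angew. Math. 784 (2022),
Thm. 1.1). In the proof of their Claim 2.2 (arXiv:2007.06756, pp. 6–7) the positive solution `u`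
of the quasi-spherical equation `H̄_t ∂_t u = u² Δ_{γ_t} u + ½ (f − R_{γ_t}) u³ + ½ (R_{γ_t} − R_ḡ) u`,
`u(·, 0) ≡ ε`, is trapped between the solutions of the two ODEs
`v' = −(M/2)(v³ + v)`, `w' = (M/2)(w³ + w)`, `v(0) = w(0) = ε`, namely (as printed)
`v(t) = ε / √((1+ε²) e^{Mt} − ε²)` and `w(t) = ε / √((1+ε²) e^{−Mt} − ε²)`; "Set
`ε₀ = e^{−M/2}` and choose an `ε ≤ ε₀`. Then … in `[0,1]` there holds
`(1+ε²)e^{−Mt} − ε² ≥ e^{−2M}`. Thus `w` exists on the whole `[0,1]`, and satisfies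
`w(t) ≤ e^M ε`", giving the two-sided bound `½ e^{−M} ε ≤ u ≤ e^{M} ε` of Claim 2.2 by the
parabolic maximum principle. This file PROVES the elementary (one-variable) half of that
argument — everything about `v` and `w`; the comparison `v ≤ u ≤ w` itself (parabolic maximum
principle on `Σ × [0, T)`) is NOT here. Theorems only (the barriers are written out), no
definitions, no named facts:

* `quasiSpherical_radicand_sub_ge_one` — `(1+ε²) e^{Mt} − ε² ≥ 1` for `M, t ≥ 0` (so `v` exists on `[0, ∞)`);
* `quasiSpherical_radicand_super_ge` — **`(1+ε²) e^{−Mt} − ε² ≥ e^{−2M}`** for `0 ≤ t ≤ 1`, `0 < ε ≤ e^{−M/2}`;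
* `hasDerivAt_quasiSphericalBarrier` — for `R(t) = (1+ε²) e^{σMt} − ε² > 0` the function
  `ε / √R` has derivative `−(σM/2)((ε/√R)³ + ε/√R)` (`σ = 1`: the subsolution `v`,
  `σ = −1`: the supersolution `w`), and value `ε` at `t = 0` (`quasiSphericalBarrier_zero`);
* `quasiSpherical_super_le` — **`w(t) ≤ e^{M} ε`** on `[0, 1]` for `ε ≤ e^{−M/2}`;
* `quasiSpherical_sub_ge` — `v(t) ≥ ½ e^{−M} ε` on `[0, 1]` for `ε ≤ 1` (the lower half of the two-sided bound).

## References

* Y. Shi, W. Wang, G. Wei, *Total mean curvature of the boundary and nonnegative scalar curvature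
  fill-ins*, J. reine angew. Math. 784 (2022) 215–250 = arXiv:2007.06756, §2, Claim 2.2 and its
  proof. [ShiWangWei2022]
-/

noncomputable section

open Real Set

namespace Literature.Geometry.Riemannian

/-- `(1 + ε²) e^{Mt} − ε² ≥ 1` for `M t ≥ 0`: the radicand of the subsolution
`v = ε / √((1+ε²)e^{Mt} − ε²)` is `≥ 1`, so `v` is defined and positive on `[0, ∞)` ("Equation
(supersolution) has a positive solution on the whole `[0,1]`"). [cite: ShiWangWei2022, proof of Claim 2.2] -/
theorem quasiSpherical_radicand_sub_ge_one {M t : ℝ} (hMt : 0 ≤ M * t) (ε : ℝ) :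
    1 ≤ (1 + ε ^ 2) * exp (M * t) - ε ^ 2 := by
  have h1 : 1 ≤ exp (M * t) := one_le_exp hMt
  nlinarith [sq_nonneg ε]

/-- **`(1 + ε²) e^{−Mt} − ε² ≥ e^{−2M}` on `[0, 1]` for `0 < ε ≤ e^{−M/2}`, `M ≥ 0`** — the printed
inequality ensuring that the supersolution `w` exists on the whole interval `[0, 1]`.
[cite: ShiWangWei2022, proof of Claim 2.2] -/
theorem quasiSpherical_radicand_super_ge {M ε t : ℝ} (hM : 0 ≤ M) (ht1 : t ≤ 1)
    (hε : ε ≤ exp (-M / 2)) (hε0 : 0 ≤ ε) :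
    exp (-2 * M) ≤ (1 + ε ^ 2) * exp (-M * t) - ε ^ 2 := by
  -- `e^{-Mt} ≥ e^{-M}` and `ε² ≤ e^{-M}`
  have h1 : exp (-M) ≤ exp (-M * t) := exp_le_exp.2 (by nlinarith)
  have h2 : ε ^ 2 ≤ exp (-M) := by
    have h := mul_self_le_mul_self hε0 hε
    rw [← exp_add] at h
    have : -M / 2 + -M / 2 = -M := by ring
    rw [this] at h
    nlinarith
  have h3 : exp (-2 * M) = exp (-M) * exp (-M) := by rw [← exp_add]; ring_nf
  have h4 : 0 < exp (-M) := exp_pos _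
  have h5 : exp (-M) ≤ 1 := exp_le_one_iff.2 (by linarith)
  -- `(1+ε²)e^{-Mt} - ε² ≥ e^{-M} + ε² e^{-M} - ε² = e^{-M} - ε²(1 - e^{-M}) ≥ e^{-M} - e^{-M}(1 - e^{-M})`
  nlinarith [mul_nonneg (sq_nonneg ε) h4.le, mul_le_mul_of_nonneg_right h2 (sub_nonneg.2 h5)]

/-- **The barriers solve their ODEs.** For `R(t) = (1 + ε²) e^{σ M t} − ε² > 0` the function
`b = ε / √R` satisfies `b' = −(σ M / 2)(b³ + b)`: with `σ = 1` this is the subsolution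
`v' = −(M/2)(v³ + v)`, with `σ = −1` the supersolution `w' = (M/2)(w³ + w)` of the proof of
Claim 2.2 (`R' = σM(R + ε²)`, `b' = −½ ε R^{−3/2} R'`). [cite: ShiWangWei2022, proof of Claim 2.2] -/
theorem hasDerivAt_quasiSphericalBarrier (M ε σ t : ℝ) (hR : 0 < (1 + ε ^ 2) * exp (σ * M * t) - ε ^ 2) :
    HasDerivAt (fun s ↦ ε / sqrt ((1 + ε ^ 2) * exp (σ * M * s) - ε ^ 2))
      (-(σ * M / 2) * ((ε / sqrt ((1 + ε ^ 2) * exp (σ * M * t) - ε ^ 2)) ^ 3 +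
        ε / sqrt ((1 + ε ^ 2) * exp (σ * M * t) - ε ^ 2))) t := by
  set R : ℝ → ℝ := fun s ↦ (1 + ε ^ 2) * exp (σ * M * s) - ε ^ 2 with hRdef
  have hRt : 0 < R t := hR
  -- derivative of the radicand
  have hR' : HasDerivAt R ((1 + ε ^ 2) * (exp (σ * M * t) * (σ * M))) t := by
    have h := ((hasDerivAt_id t).const_mul (σ * M)).exp.const_mul (1 + ε ^ 2)
    simp only [mul_one, id] at h
    exact h.sub_const (ε ^ 2)
  -- derivative of `√R`
  have hsqrt : HasDerivAt (fun s ↦ sqrt (R s))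
      ((1 + ε ^ 2) * (exp (σ * M * t) * (σ * M)) / (2 * sqrt (R t))) t :=
    hR'.sqrt hRt.ne'
  have hsqrt_pos : 0 < sqrt (R t) := sqrt_pos.2 hRt
  -- derivative of `ε / √R = ε (√R)⁻¹`
  have hdiv := HasDerivAt.const_mul ε (HasDerivAt.inv hsqrt hsqrt_pos.ne')
  have hfun : (fun s ↦ ε / sqrt ((1 + ε ^ 2) * exp (σ * M * s) - ε ^ 2)) =
      fun s ↦ ε * (sqrt (R s))⁻¹ := by
    funext s; rw [div_eq_mul_inv]
  rw [hfun]
  -- algebra: `ε · (-(R'/(2√R)) / (√R)²) = -(σM/2)(b³ + b)` with `R' = σM(R + ε²)`, `R = (√R)²`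
  have h1e : (1 + ε ^ 2) ≠ 0 := by positivity
  have hexp' : exp (σ * M * t) = (sqrt (R t) ^ 2 + ε ^ 2) / (1 + ε ^ 2) := by
    rw [eq_div_iff h1e, sq_sqrt hRt.le]
    simp only [hRdef]
    ring
  have hRt' : sqrt (R t) ≠ 0 := hsqrt_pos.ne'
  refine hdiv.congr_deriv ?_
  rw [hexp']
  have hrad : (1 + ε ^ 2) * ((sqrt (R t) ^ 2 + ε ^ 2) / (1 + ε ^ 2)) - ε ^ 2 = sqrt (R t) ^ 2 := by
    field_simp
    ring
  simp only [hrad, Real.sqrt_sq hsqrt_pos.le]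
  field_simp
  ring

/-- Both barriers start at `ε`: `ε / √((1+ε²) − ε²) = ε`. [cite: ShiWangWei2022, proof of Claim 2.2] -/
theorem quasiSphericalBarrier_zero (M ε σ : ℝ) :
    ε / sqrt ((1 + ε ^ 2) * exp (σ * M * 0) - ε ^ 2) = ε := by
  simp

/-- **`w(t) ≤ e^{M} ε` on `[0, 1]`** for `0 < ε ≤ e^{−M/2}`, `M ≥ 0` ("Thus `w` exists on the whole
`[0,1]`, and satisfies `w(t) ≤ e^M ε`"): by `quasiSpherical_radicand_super_ge`, `√R ≥ e^{−M}`.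
[cite: ShiWangWei2022, proof of Claim 2.2] -/
theorem quasiSpherical_super_le {M ε t : ℝ} (hM : 0 ≤ M) (ht1 : t ≤ 1)
    (hε : ε ≤ exp (-M / 2)) (hε0 : 0 < ε) :
    ε / sqrt ((1 + ε ^ 2) * exp (-M * t) - ε ^ 2) ≤ exp M * ε := by
  have hR := quasiSpherical_radicand_super_ge hM ht1 hε hε0.le
  have hpos : 0 < exp (-2 * M) := exp_pos _
  have hsqrt : exp (-M) ≤ sqrt ((1 + ε ^ 2) * exp (-M * t) - ε ^ 2) := by
    have h2 : sqrt (exp (-2 * M)) = exp (-M) := by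
      rw [show exp (-2 * M) = exp (-M) ^ 2 by rw [sq, ← exp_add]; ring_nf]
      exact sqrt_sq (exp_pos _).le
    rw [← h2]
    exact sqrt_le_sqrt hR
  have hexp : 0 < exp (-M) := exp_pos _
  calc ε / sqrt ((1 + ε ^ 2) * exp (-M * t) - ε ^ 2) ≤ ε / exp (-M) :=
        div_le_div_of_nonneg_left hε0.le hexp hsqrt
    _ = exp M * ε := by rw [exp_neg]; field_simp

/-- **`v(t) ≥ ½ e^{−M} ε` on `[0, 1]`** for `0 < ε ≤ 1`, `M ≥ 0` — the lower half of the two-sided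
bound `½ e^{−M} ε ≤ u ≤ e^{M} ε` of Claim 2.2 (`u ≥ v`): `√((1+ε²)e^{Mt} − ε²) ≤ √(2 e^{M}) ≤ 2 e^{M}`.
[cite: ShiWangWei2022, Claim 2.2 and its proof] -/
theorem quasiSpherical_sub_ge {M ε t : ℝ} (hM : 0 ≤ M) (ht0 : 0 ≤ t) (ht1 : t ≤ 1) (hε1 : ε ≤ 1)
    (hε0 : 0 < ε) :
    exp (-M) * ε / 2 ≤ ε / sqrt ((1 + ε ^ 2) * exp (M * t) - ε ^ 2) := by
  have hR1 : 1 ≤ (1 + ε ^ 2) * exp (M * t) - ε ^ 2 :=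
    quasiSpherical_radicand_sub_ge_one (mul_nonneg hM ht0) ε
  have hRpos : 0 < (1 + ε ^ 2) * exp (M * t) - ε ^ 2 := by linarith
  -- upper bound for the radicand: `≤ 2 e^{M} ≤ (2 e^{M})²`
  have hexp1 : exp (M * t) ≤ exp M := exp_le_exp.2 (by nlinarith)
  have hexpM : 1 ≤ exp M := one_le_exp hM
  have hup : (1 + ε ^ 2) * exp (M * t) - ε ^ 2 ≤ (2 * exp M) ^ 2 := by
    have hε2 : ε ^ 2 ≤ 1 := by nlinarith
    nlinarith [exp_pos (M * t), exp_pos M, sq_nonneg ε]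
  have hsqrt : sqrt ((1 + ε ^ 2) * exp (M * t) - ε ^ 2) ≤ 2 * exp M := by
    rw [← sqrt_sq (by positivity : (0 : ℝ) ≤ 2 * exp M)]
    exact sqrt_le_sqrt hup
  have hsqrt_pos : 0 < sqrt ((1 + ε ^ 2) * exp (M * t) - ε ^ 2) := sqrt_pos.2 hRpos
  have h2 : 0 < 2 * exp M := by positivity
  calc exp (-M) * ε / 2 = ε / (2 * exp M) := by rw [exp_neg]; field_simp
    _ ≤ ε / sqrt ((1 + ε ^ 2) * exp (M * t) - ε ^ 2) :=
        div_le_div_of_nonneg_left hε0.le hsqrt_pos hsqrt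

end Literature.Geometry.Riemannian

end
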